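import Summits.RiemannHypothesis.RiemannHypothesis.Theorems.WeilFormatCDataO106FrontDataW
import Summits.RiemannHypothesis.RiemannHypothesis.Theorems.WeilFormatCDataA1RungCB
import Summits.RiemannHypothesis.RiemannHypothesis.Theorems.S2FormatCE0
import Literature.NumberTheory.LFunctions.YoshidaWindowGramTailMSSines
import Literature.NumberTheory.LFunctions.YoshidaWindowGramMiddleJBox
import Literature.NumberTheory.LFunctions.YoshidaWindowGramTailJFactoredScaled
import Literature.NumberTheory.LFunctions.YoshidaWindowGramTailMSFactored
import Literature.NumberTheory.LFunctions.YoshidaWindowGramTailJDiagTight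
import Summits.RiemannHypothesis.RiemannHypothesis.Theorems.FormatCPsdBands
import Summits.RiemannHypothesis.RiemannHypothesis.Theorems.WeilFormatCDiagShift
import Summits.RiemannHypothesis.RiemannHypothesis.Theorems.FormatCPsdSymmBands
import HarnessLib
import Summits.RiemannHypothesis.RiemannHypothesis.Theorems.WeilFormatCDataO106Tables1
import Summits.RiemannHypothesis.RiemannHypothesis.Theorems.WeilFormatCDataO106Tables2
import Summits.RiemannHypothesis.RiemannHypothesis.Theorems.WeilFormatCDataO106Tables3
import Summits.RiemannHypothesis.RiemannHypothesis.Theorems.WeilFormatCDataO106Tables4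
import Summits.RiemannHypothesis.RiemannHypothesis.Theorems.WeilFormatCDataO106Tables5
import Summits.RiemannHypothesis.RiemannHypothesis.Theorems.WeilFormatCDataO106Tables
import Summits.RiemannHypothesis.RiemannHypothesis.Theorems.WeilFormatCDataO106ColTables1
import Summits.RiemannHypothesis.RiemannHypothesis.Theorems.WeilFormatCDataO106ColTables2
import Summits.RiemannHypothesis.RiemannHypothesis.Theorems.WeilFormatCDataO106ColTables3
import Summits.RiemannHypothesis.RiemannHypothesis.Theorems.WeilFormatCDataO106ColTables4
import Summits.RiemannHypothesis.RiemannHypothesis.Theorems.WeilFormatCDataO106ColTables5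
import Summits.RiemannHypothesis.RiemannHypothesis.Theorems.WeilFormatCDataO106ColTables6
import Summits.RiemannHypothesis.RiemannHypothesis.Theorems.WeilFormatCDataO106ColTables7
import Summits.RiemannHypothesis.RiemannHypothesis.Theorems.WeilFormatCDataO106ColTables8
import Summits.RiemannHypothesis.RiemannHypothesis.Theorems.WeilFormatCDataO106ColTables9
import Summits.RiemannHypothesis.RiemannHypothesis.Theorems.WeilFormatCDataO106ColTables10
import Summits.RiemannHypothesis.RiemannHypothesis.Theorems.WeilFormatCDataO106ColTables11
import Summits.RiemannHypothesis.RiemannHypothesis.Theorems.WeilFormatCDataO106ColTables12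
import Summits.RiemannHypothesis.RiemannHypothesis.Theorems.WeilFormatCDataO106ColTables13
import Summits.RiemannHypothesis.RiemannHypothesis.Theorems.WeilFormatCDataO106ColTables14
import Summits.RiemannHypothesis.RiemannHypothesis.Theorems.WeilFormatCDataO106ColTables15
import Summits.RiemannHypothesis.RiemannHypothesis.Theorems.WeilFormatCDataO106ColTables16
import Summits.RiemannHypothesis.RiemannHypothesis.Theorems.WeilFormatCDataO106ColTables17
import Summits.RiemannHypothesis.RiemannHypothesis.Theorems.WeilFormatCDataO106ColTables18
import Summits.RiemannHypothesis.RiemannHypothesis.Theorems.WeilFormatCDataO106ColTables19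
import Summits.RiemannHypothesis.RiemannHypothesis.Theorems.WeilFormatCDataO106ColTables20
import Summits.RiemannHypothesis.RiemannHypothesis.Theorems.WeilFormatCDataO106ColTables21
import Summits.RiemannHypothesis.RiemannHypothesis.Theorems.WeilFormatCDataO106ColTables22
import Summits.RiemannHypothesis.RiemannHypothesis.Theorems.WeilFormatCDataO106ColTables23
import Summits.RiemannHypothesis.RiemannHypothesis.Theorems.WeilFormatCDataO106ColTables24
import Summits.RiemannHypothesis.RiemannHypothesis.Theorems.WeilFormatCDataO106ColTables25
import Summits.RiemannHypothesis.RiemannHypothesis.Theorems.WeilFormatCDataO106ColTables26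
import Summits.RiemannHypothesis.RiemannHypothesis.Theorems.WeilFormatCDataO106ColTables27
import Summits.RiemannHypothesis.RiemannHypothesis.Theorems.WeilFormatCDataO106ColTables28
import Summits.RiemannHypothesis.RiemannHypothesis.Theorems.WeilFormatCDataO106ColTables29
import Summits.RiemannHypothesis.RiemannHypothesis.Theorems.WeilFormatCDataO106ColTables30
import Summits.RiemannHypothesis.RiemannHypothesis.Theorems.WeilFormatCDataO106ColTables31
import Summits.RiemannHypothesis.RiemannHypothesis.Theorems.WeilFormatCDataO106ColTables32
import Summits.RiemannHypothesis.RiemannHypothesis.Theorems.WeilFormatCDataO106ColTables33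
import Summits.RiemannHypothesis.RiemannHypothesis.Theorems.WeilFormatCDataO106ColTables34
import Summits.RiemannHypothesis.RiemannHypothesis.Theorems.WeilFormatCDataO106ColTables35
import Summits.RiemannHypothesis.RiemannHypothesis.Theorems.WeilFormatCDataO106ColTables
import Summits.RiemannHypothesis.RiemannHypothesis.Theorems.WeilFormatCDataO106CBOddXP1
import Summits.RiemannHypothesis.RiemannHypothesis.Theorems.WeilFormatCDataO106CBOddXP2
import Summits.RiemannHypothesis.RiemannHypothesis.Theorems.WeilFormatCDataO106CBOddXP3
import Summits.RiemannHypothesis.RiemannHypothesis.Theorems.WeilFormatCDataO106CBOddXP4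
import Summits.RiemannHypothesis.RiemannHypothesis.Theorems.WeilFormatCDataO106CBOddXP5
import Summits.RiemannHypothesis.RiemannHypothesis.Theorems.WeilFormatCDataO106CBOddXP6
import Summits.RiemannHypothesis.RiemannHypothesis.Theorems.WeilFormatCDataO106CBOddXP7
import Summits.RiemannHypothesis.RiemannHypothesis.Theorems.WeilFormatCDataO106CBOddXP8
import Summits.RiemannHypothesis.RiemannHypothesis.Theorems.WeilFormatCDataO106CBOddXP9
import Summits.RiemannHypothesis.RiemannHypothesis.Theorems.WeilFormatCDataO106CBOddXP10
import Summits.RiemannHypothesis.RiemannHypothesis.Theorems.WeilFormatCDataO106CBOddXP11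
import Summits.RiemannHypothesis.RiemannHypothesis.Theorems.WeilFormatCDataO106CBOddXP12
import Summits.RiemannHypothesis.RiemannHypothesis.Theorems.WeilFormatCDataO106CBOddXP13
import Summits.RiemannHypothesis.RiemannHypothesis.Theorems.WeilFormatCDataO106CBOddXP14
import Summits.RiemannHypothesis.RiemannHypothesis.Theorems.WeilFormatCDataO106CBOddXP15
import Summits.RiemannHypothesis.RiemannHypothesis.Theorems.WeilFormatCDataO106CBOddXP16
import Summits.RiemannHypothesis.RiemannHypothesis.Theorems.WeilFormatCDataO106CBOddXP17
import Summits.RiemannHypothesis.RiemannHypothesis.Theorems.WeilFormatCDataO106CBOddXP18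
import Summits.RiemannHypothesis.RiemannHypothesis.Theorems.WeilFormatCDataO106CBOddXP19
import Summits.RiemannHypothesis.RiemannHypothesis.Theorems.WeilFormatCDataO106CBOddXP20
import Summits.RiemannHypothesis.RiemannHypothesis.Theorems.WeilFormatCDataO106CBOddXP21
import Summits.RiemannHypothesis.RiemannHypothesis.Theorems.WeilFormatCDataO106CBOddXP22
import Summits.RiemannHypothesis.RiemannHypothesis.Theorems.WeilFormatCDataO106CBOddXP23
import Summits.RiemannHypothesis.RiemannHypothesis.Theorems.WeilFormatCDataO106CBOddXP24
import Summits.RiemannHypothesis.RiemannHypothesis.Theorems.WeilFormatCDataO106CBOddXP25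
import Summits.RiemannHypothesis.RiemannHypothesis.Theorems.WeilFormatCDataO106CBOddDSP1
import Summits.RiemannHypothesis.RiemannHypothesis.Theorems.WeilFormatCDataO106CBOddDSP2
import Summits.RiemannHypothesis.RiemannHypothesis.Theorems.WeilFormatCDataO106CBOddDSP3
import Summits.RiemannHypothesis.RiemannHypothesis.Theorems.WeilFormatCDataO106CBOddDSP4
import Summits.RiemannHypothesis.RiemannHypothesis.Theorems.WeilFormatCDataO106CBOddDSP5
import Summits.RiemannHypothesis.RiemannHypothesis.Theorems.WeilFormatCDataO106CBOddDSP6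
import Summits.RiemannHypothesis.RiemannHypothesis.Theorems.WeilFormatCDataO106CBOddDSP7
import Summits.RiemannHypothesis.RiemannHypothesis.Theorems.WeilFormatCDataO106CBOddDSP8
import Summits.RiemannHypothesis.RiemannHypothesis.Theorems.WeilFormatCDataO106CBOddDSP9
import Summits.RiemannHypothesis.RiemannHypothesis.Theorems.WeilFormatCDataO106CBOddDSP10
import Summits.RiemannHypothesis.RiemannHypothesis.Theorems.WeilFormatCDataO106CBOddDSP11
import Summits.RiemannHypothesis.RiemannHypothesis.Theorems.WeilFormatCDataO106CBOddDSP12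
import Summits.RiemannHypothesis.RiemannHypothesis.Theorems.WeilFormatCDataO106CBOddDSP13
import Summits.RiemannHypothesis.RiemannHypothesis.Theorems.WeilFormatCDataO106CBOddDSP14
import Summits.RiemannHypothesis.RiemannHypothesis.Theorems.WeilFormatCDataO106CBOddDSP15
import Summits.RiemannHypothesis.RiemannHypothesis.Theorems.WeilFormatCDataO106CBOddDSP16
import Summits.RiemannHypothesis.RiemannHypothesis.Theorems.WeilFormatCDataO106CBOddDSP17
import Summits.RiemannHypothesis.RiemannHypothesis.Theorems.WeilFormatCDataO106CBOddDSP18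
import Summits.RiemannHypothesis.RiemannHypothesis.Theorems.WeilFormatCDataO106CBOddDSP19
import Summits.RiemannHypothesis.RiemannHypothesis.Theorems.WeilFormatCDataO106CBOddDSP20
import Summits.RiemannHypothesis.RiemannHypothesis.Theorems.WeilFormatCDataO106CBOddDSP21
import Summits.RiemannHypothesis.RiemannHypothesis.Theorems.WeilFormatCDataO106CBOddDSP22
import Summits.RiemannHypothesis.RiemannHypothesis.Theorems.WeilFormatCDataO106CBOddDSP23
import Summits.RiemannHypothesis.RiemannHypothesis.Theorems.WeilFormatCDataO106CBOddDSP24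
import Summits.RiemannHypothesis.RiemannHypothesis.Theorems.WeilFormatCDataO106CBOddDSP25
import Summits.RiemannHypothesis.RiemannHypothesis.Theorems.WeilFormatCDataO106CBOddDSP26
import Summits.RiemannHypothesis.RiemannHypothesis.Theorems.WeilFormatCDataO106CBOddDSP27
import Summits.RiemannHypothesis.RiemannHypothesis.Theorems.WeilFormatCDataO106CBOddDSP28
import Summits.RiemannHypothesis.RiemannHypothesis.Theorems.WeilFormatCDataO106CBOddDSP29
import Summits.RiemannHypothesis.RiemannHypothesis.Theorems.WeilFormatCDataO106CBOddDSP30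
import Summits.RiemannHypothesis.RiemannHypothesis.Theorems.WeilFormatCDataO106CBOddLP1
import Summits.RiemannHypothesis.RiemannHypothesis.Theorems.WeilFormatCDataO106CBOddLP2
import Summits.RiemannHypothesis.RiemannHypothesis.Theorems.WeilFormatCDataO106CBOddLP3
import Summits.RiemannHypothesis.RiemannHypothesis.Theorems.WeilFormatCDataO106CBOddLP4
import Summits.RiemannHypothesis.RiemannHypothesis.Theorems.WeilFormatCDataO106CBOddLP5
import Summits.RiemannHypothesis.RiemannHypothesis.Theorems.WeilFormatCDataO106CBOddLP6
import Summits.RiemannHypothesis.RiemannHypothesis.Theorems.WeilFormatCDataO106CBOddLP7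
import Summits.RiemannHypothesis.RiemannHypothesis.Theorems.WeilFormatCDataO106CBOddLP8
import Summits.RiemannHypothesis.RiemannHypothesis.Theorems.WeilFormatCDataO106CBOddLP9
import Summits.RiemannHypothesis.RiemannHypothesis.Theorems.WeilFormatCDataO106CBOddLP10
import Summits.RiemannHypothesis.RiemannHypothesis.Theorems.WeilFormatCDataO106CBOddLP11
import Summits.RiemannHypothesis.RiemannHypothesis.Theorems.WeilFormatCDataO106CBOddLP12
import Summits.RiemannHypothesis.RiemannHypothesis.Theorems.WeilFormatCDataO106CBOddPhiP1
import Summits.RiemannHypothesis.RiemannHypothesis.Theorems.WeilFormatCDataO106CBOddPsiP1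
import Summits.RiemannHypothesis.RiemannHypothesis.Theorems.WeilFormatCDataO106CBOddRD
import Summits.RiemannHypothesis.RiemannHypothesis.Theorems.WeilFormatCDataO106FrontData
import Summits.RiemannHypothesis.RiemannHypothesis.Theorems.WeilFormatCDataO106CBOddPsd0
import Summits.RiemannHypothesis.RiemannHypothesis.Theorems.WeilFormatCDataO106CBOddPsd1
import Summits.RiemannHypothesis.RiemannHypothesis.Theorems.WeilFormatCDataO106CBOddPsd2
import Summits.RiemannHypothesis.RiemannHypothesis.Theorems.WeilFormatCDataO106CBOddPsd3
import Summits.RiemannHypothesis.RiemannHypothesis.Theorems.WeilFormatCDataO106CBOddPsd4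
import Summits.RiemannHypothesis.RiemannHypothesis.Theorems.WeilFormatCDataO106CBOddPsd5
import Summits.RiemannHypothesis.RiemannHypothesis.Theorems.WeilFormatCDataO106CBOddPsd6
import Summits.RiemannHypothesis.RiemannHypothesis.Theorems.WeilFormatCDataO106CBOddPsd7
import Summits.RiemannHypothesis.RiemannHypothesis.Theorems.WeilFormatCDataO106CBOddPsd8
import Summits.RiemannHypothesis.RiemannHypothesis.Theorems.WeilFormatCDataO106CBOddPsd9
import Summits.RiemannHypothesis.RiemannHypothesis.Theorems.WeilFormatCDataO106CBOddPsd10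
import Summits.RiemannHypothesis.RiemannHypothesis.Theorems.WeilFormatCDataO106CBOddPsd11
import Summits.RiemannHypothesis.RiemannHypothesis.Theorems.WeilFormatCDataO106CBOddPsd12
import Summits.RiemannHypothesis.RiemannHypothesis.Theorems.WeilFormatCDataO106CBOddPsd13
import Summits.RiemannHypothesis.RiemannHypothesis.Theorems.WeilFormatCDataO106CBOddPsd14
import Summits.RiemannHypothesis.RiemannHypothesis.Theorems.WeilFormatCDataO106CBOddPsd15
import Summits.RiemannHypothesis.RiemannHypothesis.Theorems.WeilFormatCDataO106CBOddPsd16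
import Summits.RiemannHypothesis.RiemannHypothesis.Theorems.WeilFormatCDataO106CBOddPsd17
import Summits.RiemannHypothesis.RiemannHypothesis.Theorems.WeilFormatCDataO106CBOddPsd18
import Summits.RiemannHypothesis.RiemannHypothesis.Theorems.WeilFormatCDataO106CBOddPsd19A
import Summits.RiemannHypothesis.RiemannHypothesis.Theorems.WeilFormatCDataO106CBOddPsd19B
import Summits.RiemannHypothesis.RiemannHypothesis.Theorems.WeilFormatCDataO106OddAsmX

/-!
# Format C kernel rung `O106` (a = 53/50, column-band layout): ASSEMBLY of the flat layout, part Y of 26 (ladders of CBOddPsd19 (cont.); split of the 4013-line assembly at block boundaries by prover B g19 for the 400-line cap; blocks byte-identical): every propositional ladder of the kernel files (table/column validity, front door, sines, middle moments, column data, tail factors, Schur rows, (P) + diagonal shift), byte-identical statements and proofs, original order (A g22 restage_flat.py; weil-2 KERNEL-CHAIN-RULES #1)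

Window `a = 53/50`; prime powers in the window: 2, 3, 2^2, 5, 7, 2^3; prime constant A = 2358/1000 (`WeilFormatC.primeCoeff_form_ge_cells_1098`); evaluator parameters S = 2^320, Kpi 160, Kser 190, kred 8, Kexp 55, J 150; full table modes < 321; light column table modes < 2051; units 2^-310 (Schur entries), 2^-154 (column digits, width 157), 2^-148 (tail-factor digits, width 151), 2^-64 (reciprocal weights), 2^-40 (tail base); order-J tail J = 4, θ = 1/2048, η = 1/10 | 4/1.
Design row: sr-gb-rung-b B g21 hp odd λ-run (parity CELL 15 L-side, the first window PAST the (log 8)/2 resonance): a = 53/50, SIX prime powers 2,3,4,5,7,8 (kmax 8), A = 2358/1000 (WeilFormatC.primeCoeff_form_ge_cells_1098), μ = 2^-103, odd 320/640/2048, kit precision S 2^320 / c 310 / Kpi 160 / Kser 190 / Kexp 55 / J 150; pairs with A g24 trialUpper1035sharp = 21e-33; see HOME(B)/CELL14-LSIDE-B-g21.md §4. Generated by sr-gb-rung-a prover A g22 with rh-explicit-weil-2 gen7's generator extended for the odd λ-run (--sector odd --mu-log2; HOME(A)/code-g22/gen7/gramgen7.py sha16 b21c15hp1060001) from `#eval`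 of the tree's `Encl` functions; every datum is re-verified by the kernel in the theorem files (`decide +kernel`). Helper data of the rh-explicit Weil-positivity programme (format C, K-CELL-2), RH-free. [cite: Yoshida1992HermitianForms, §5 (5.15)-(5.16) p. 301; §7 pp. 305–312]
-/

set_option linter.dupNamespace false
set_option exponentiation.threshold 1024
set_option maxRecDepth 200000

-- ===== from WeilFormatCDataO106CBOddPsd19 (continued) =====
namespace Summit.RiemannHypothesis.RiemannHypothesis.Theorems.WeilFormatCData.O106CBOdd
open Literature.NumberTheory.LFunctions Literature.NumberTheory.LFunctions.PsdDyadic Summit.RiemannHypothesis.RiemannHypothesis.Theorems.FormatCPsd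

/-- **(P)**: `checkPsdMid 320 δ rho DS' L` (assembled from the row bands). -/
theorem checkPsdMid_holds : checkPsdMid 320 O106CBOdd.δ O106CBOdd.rho O106CBOdd.DS' O106CBOdd.L = true := by
  refine checkPsdMid_of_bands tShape fun t ht ↦ ?_
  have hlen : t < DS'.length := by rw [tLen]; exact ht
  by_cases hb0 : t < 8
  · exact rowBudget_of_checkPsdBand tPB0 (by omega) (by omega) hlen
  by_cases hb8 : t < 16
  · exact rowBudget_of_checkPsdBand tPB8 (by omega) (by omega) hlen
  by_cases hb16 : t < 24
  · exact rowBudget_of_checkPsdBand tPB16 (by omega) (by omega) hlen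
  by_cases hb24 : t < 32
  · exact rowBudget_of_checkPsdBand tPB24 (by omega) (by omega) hlen
  by_cases hb32 : t < 40
  · exact rowBudget_of_checkPsdBand tPB32 (by omega) (by omega) hlen
  by_cases hb40 : t < 48
  · exact rowBudget_of_checkPsdBand tPB40 (by omega) (by omega) hlen
  by_cases hb48 : t < 56
  · exact rowBudget_of_checkPsdBand tPB48 (by omega) (by omega) hlen
  by_cases hb56 : t < 64
  · exact rowBudget_of_checkPsdBand tPB56 (by omega) (by omega) hlen
  by_cases hb64 : t < 72
  · exact rowBudget_of_checkPsdBand tPB64 (by omega) (by omega) hlen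
  by_cases hb72 : t < 80
  · exact rowBudget_of_checkPsdBand tPB72 (by omega) (by omega) hlen
  by_cases hb80 : t < 88
  · exact rowBudget_of_checkPsdBand tPB80 (by omega) (by omega) hlen
  by_cases hb88 : t < 96
  · exact rowBudget_of_checkPsdBand tPB88 (by omega) (by omega) hlen
  by_cases hb96 : t < 104
  · exact rowBudget_of_checkPsdBand tPB96 (by omega) (by omega) hlen
  by_cases hb104 : t < 112
  · exact rowBudget_of_checkPsdBand tPB104 (by omega) (by omega) hlen
  by_cases hb112 : t < 120
  · exact rowBudget_of_checkPsdBand tPB112 (by omega) (by omega) hlen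
  by_cases hb120 : t < 128
  · exact rowBudget_of_checkPsdBand tPB120 (by omega) (by omega) hlen
  by_cases hb128 : t < 136
  · exact rowBudget_of_checkPsdBand tPB128 (by omega) (by omega) hlen
  by_cases hb136 : t < 144
  · exact rowBudget_of_checkPsdBand tPB136 (by omega) (by omega) hlen
  by_cases hb144 : t < 152
  · exact rowBudget_of_checkPsdBand tPB144 (by omega) (by omega) hlen
  by_cases hb152 : t < 160
  · exact rowBudget_of_checkPsdBand tPB152 (by omega) (by omega) hlen
  by_cases hb160 : t < 168
  · exact rowBudget_of_checkPsdBand tPB160 (by omega) (by omega) hlen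
  by_cases hb168 : t < 176
  · exact rowBudget_of_checkPsdBand tPB168 (by omega) (by omega) hlen
  by_cases hb176 : t < 184
  · exact rowBudget_of_checkPsdBand tPB176 (by omega) (by omega) hlen
  by_cases hb184 : t < 192
  · exact rowBudget_of_checkPsdBand tPB184 (by omega) (by omega) hlen
  by_cases hb192 : t < 200
  · exact rowBudget_of_checkPsdBand tPB192 (by omega) (by omega) hlen
  by_cases hb200 : t < 208
  · exact rowBudget_of_checkPsdBand tPB200 (by omega) (by omega) hlen
  by_cases hb208 : t < 216
  · exact rowBudget_of_checkPsdBand tPB208 (by omega) (by omega) hlen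
  by_cases hb216 : t < 224
  · exact rowBudget_of_checkPsdBand tPB216 (by omega) (by omega) hlen
  by_cases hb224 : t < 232
  · exact rowBudget_of_checkPsdBand tPB224 (by omega) (by omega) hlen
  by_cases hb232 : t < 240
  · exact rowBudget_of_checkPsdBand tPB232 (by omega) (by omega) hlen
  by_cases hb240 : t < 248
  · exact rowBudget_of_checkPsdBand tPB240 (by omega) (by omega) hlen
  by_cases hb248 : t < 256
  · exact rowBudget_of_checkPsdBand tPB248 (by omega) (by omega) hlen
  by_cases hb256 : t < 264
  · exact rowBudget_of_checkPsdBand tPB256 (by omega) (by omega) hlen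
  by_cases hb264 : t < 272
  · exact rowBudget_of_checkPsdBand tPB264 (by omega) (by omega) hlen
  by_cases hb272 : t < 280
  · exact rowBudget_of_checkPsdBand tPB272 (by omega) (by omega) hlen
  by_cases hb280 : t < 288
  · exact rowBudget_of_checkPsdBand tPB280 (by omega) (by omega) hlen
  by_cases hb288 : t < 296
  · exact rowBudget_of_checkPsdBand tPB288 (by omega) (by omega) hlen
  by_cases hb296 : t < 304
  · exact rowBudget_of_checkPsdBand tPB296 (by omega) (by omega) hlen
  by_cases hb304 : t < 312
  · exact rowBudget_of_checkPsdBand tPB304 (by omega) (by omega) hlen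
  exact rowBudget_of_checkPsdBand tPB312 (by omega) (by omega) hlen

end Summit.RiemannHypothesis.RiemannHypothesis.Theorems.WeilFormatCData.O106CBOdd
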